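import Summits.CriticalPhenomena.PercolationContinuityZ3.Theorems.SahiMasterFamilyGluedFrames

/-!
# Glued frames, II: two frame failures, the product formula, and the ANTIPODALITY lemma

Unit `prim-master-conj` (crux anchor stmt-CriticalPhenomena-4575), gen 11; memo HOME/prim-master-conj/TIGHTNESS-III.md §1.2, §2.1, §2.6.
Continues `SahiMasterFamilyGluedFrames`.  For a family `U` with structured contraction faces and its glued frame field `gframe U W`:

* chain lemmas (any structured family `Φ`): `two_le_card_filter_pre` — a configuration annihilated by the member `u` of a good chain
  fails the frames of at least two members BEFORE `u` (T′ for the prefix, `annihilator_subset_safe_pre` + `two_le_card_frameFail`);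
  `mem_pre_of_fail_subset_pair` — so if it fails at most the frames of `a` and `b`, both come before `u`; `not_mem_pre_of_mem_pre`;
  **`false_of_cross_annihilators`** — two members `v ≠ w` of one good chain cannot carry annihilator points `χ` (of `v`, failing at most
  the frames of `p` and `w`) and `ψ` (of `w`, failing at most the frames of `q` and `v`): each would have to precede the other;
* **`two_le_card_gfail`** (TIGHTNESS-III 2.1, (F2)): a non-empty configuration of the glued annihilator of `w` fails the glued frames of at
  least two other members; `mem_of_forall_mem_gframe` — a non-empty configuration lying in every glued frame lies in every member
  (`⋂ gframe = ⋂ U` off the bottom point);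
* **`false_of_cross_gann`** (TIGHTNESS-III 2.6, one contraction face): the antipodality lemma in the glued language — annihilator points
  `χ ∈ gann v`, `ψ ∈ gann w` of the above failure types cannot share a coordinate.
Pure combinatorics on top of the gen-6 structure theory; axioms standard. [this work]
-/

noncomputable section

open scoped Classical

namespace Summit.CriticalPhenomena.PercolationContinuityZ3.Theorems

namespace GluedFrames

open Finset Function
open Literature.Probability.LatticeModels.Kahn2022 (Affects)

variable {ι : Type*} [Fintype ι] {κ : Type*}

/-! ### Chain lemmas: annihilator points fail two earlier frames -/

section Chain

variable (Φ : κ → Set (Set ι))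

/-- **T′ for the prefix**: a configuration annihilated by the member `u` of a good chain fails the frames of at least two members that
come before `u`. [this work] -/
theorem two_le_card_filter_pre (hΦ : ∀ k, IsUpperSet (Φ k)) {l : List κ} (hl : GoodChain Φ l) {u : κ} (hu : u ∈ l) {φ : Set ι}
    (hφA : φ ∈ frameIn Φ l u) (hφU : φ ∉ Φ u) :
    2 ≤ ((pre l u).toFinset.filter fun w => φ ∉ frameIn Φ l w).card := by
  have hsafe : φ ∈ Safe Φ (pre l u).toFinset := annihilator_subset_safe_pre Φ hl hu ⟨hφA, hφU⟩
  obtain ⟨l₁, hl₁⟩ := exists_append_pre hu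
  have hpre : GoodChain Φ (pre l u) := GoodChain.tail Φ (GoodChain.of_append Φ l₁ (hl₁ ▸ hl))
  have h2 := two_le_card_frameFail Φ (pre l u).length le_rfl hpre hΦ φ (Or.inl hsafe)
  refine h2.trans (card_le_card fun w hw => ?_)
  rw [mem_frameFail] at hw
  rw [mem_filter, List.mem_toFinset]
  exact ⟨hw.1, by rw [← frameIn_pre_eq Φ hl hu hw.1]; exact hw.2⟩

/-- If an annihilator point of `u` fails, among the frames of the other members, at most those of `a` and `b`, then `a ≠ b` and both
come before `u`. [this work] -/
theorem mem_pre_of_fail_subset_pair (hΦ : ∀ k, IsUpperSet (Φ k)) {l : List κ} (hl : GoodChain Φ l) {u : κ} (hu : u ∈ l) {φ : Set ι}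
    (hφA : φ ∈ frameIn Φ l u) (hφU : φ ∉ Φ u) {a b : κ} (hQ : ∀ w ∈ l, φ ∉ frameIn Φ l w → w = a ∨ w = b) :
    a ∈ pre l u ∧ b ∈ pre l u := by
  have h2 := two_le_card_filter_pre Φ hΦ hl hu hφA hφU
  set S := (pre l u).toFinset.filter fun w => φ ∉ frameIn Φ l w with hSdef
  have hS : S ⊆ {a, b} := by
    intro w hw
    rw [hSdef, mem_filter, List.mem_toFinset] at hw
    rcases hQ w (pre_subset hu w hw.1) hw.2 with h | h <;> simp [h]
  -- a set of size ≥ 2 inside `{a, b}` is `{a, b}`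
  have hab : a ≠ b := by
    intro h; subst h
    have : S.card ≤ 1 := (card_le_card hS).trans (by simp)
    omega
  have hSeq : S = {a, b} := by
    refine Finset.Subset.antisymm hS fun x hx => ?_
    by_contra hxS
    have : S ⊆ ({a, b} : Finset κ).erase x := fun y hy => mem_erase.2 ⟨fun h => hxS (h ▸ hy), hS hy⟩
    have hc := (card_le_card this).trans_eq (card_erase_of_mem hx)
    rw [card_pair hab] at hc
    omega
  have ha : a ∈ S := by rw [hSeq]; simp
  have hb : b ∈ S := by rw [hSeq]; simp
  rw [hSdef, mem_filter, List.mem_toFinset] at ha hb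
  exact ⟨ha.1, hb.1⟩

omit [Fintype ι] in
/-- `w ∈ pre l v` forces `v ∈ l`. [this work] -/
theorem mem_of_mem_pre : ∀ {l : List κ} {v w : κ}, w ∈ pre l v → v ∈ l
  | [], _, _, h => by simp [pre] at h
  | x :: l, v, w, h => by
    by_cases hv : v = x
    · subst hv; exact List.mem_cons_self
    · rw [pre_cons_of_ne hv] at h; exact List.mem_cons_of_mem x (mem_of_mem_pre h)

omit [Fintype ι] in
/-- In a list without repetitions, "comes before" is antisymmetric. [this work] -/
theorem not_mem_pre_of_mem_pre : ∀ {l : List κ}, l.Nodup → ∀ {v w : κ}, w ∈ pre l v → v ∉ pre l w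
  | [], _, _, _, h => by simp [pre] at h
  | x :: l, hn, v, w, h => by
    have hx : x ∉ l := (List.nodup_cons.1 hn).1
    have hn' : l.Nodup := (List.nodup_cons.1 hn).2
    by_cases hv : v = x
    · subst hv
      rw [pre_cons_self] at h
      have hwv : w ≠ v := fun e => hx (e ▸ h)
      rw [pre_cons_of_ne hwv]
      exact fun hmem => hx (pre_subset h v hmem)
    · rw [pre_cons_of_ne hv] at h
      have hwx : w ≠ x := fun e => hx (e ▸ pre_subset (mem_of_mem_pre h) w h)
      rw [pre_cons_of_ne hwx]
      exact not_mem_pre_of_mem_pre hn' h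

/-- **Cross annihilators are impossible in one good chain.**  If `v ≠ w` are members, `χ` is an annihilator point of `v` failing (among the
frames of the chain) at most the frames of `p` and `w`, and `ψ` an annihilator point of `w` failing at most the frames of `q` and `v`, then `w`
precedes `v` and `v` precedes `w` — contradiction. [this work] -/
theorem false_of_cross_annihilators (hΦ : ∀ k, IsUpperSet (Φ k)) {l : List κ} (hl : GoodChain Φ l) {v w p q : κ}
    (hv : v ∈ l) (hw : w ∈ l) {χ ψ : Set ι}
    (hχA : χ ∈ frameIn Φ l v) (hχU : χ ∉ Φ v) (hχQ : ∀ u ∈ l, χ ∉ frameIn Φ l u → u = p ∨ u = w)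
    (hψA : ψ ∈ frameIn Φ l w) (hψU : ψ ∉ Φ w) (hψQ : ∀ u ∈ l, ψ ∉ frameIn Φ l u → u = q ∨ u = v) : False := by
  have h1 := (mem_pre_of_fail_subset_pair Φ hΦ hl hv hχA hχU hχQ).2   -- w ∈ pre l v
  have h2 := (mem_pre_of_fail_subset_pair Φ hΦ hl hw hψA hψU hψQ).2   -- v ∈ pre l w
  exact not_mem_pre_of_mem_pre (GoodChain.nodup Φ hl) h1 h2

/-- **Canonical form**: the same for a structured family, with canonical frames. [this work] -/
theorem false_of_cross_annihilators_cframe (hΦ : ∀ k, IsUpperSet (Φ k)) (hΦne : ∀ k, (Φ k).Nonempty) {W : Finset κ}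
    (hW : Structured Φ W) {v w p q : κ} (hv : v ∈ W) (hw : w ∈ W) {χ ψ : Set ι}
    (hχA : χ ∈ cframe Φ W v) (hχU : χ ∉ Φ v) (hχQ : ∀ u ∈ W, χ ∉ cframe Φ W u → u = p ∨ u = w)
    (hψA : ψ ∈ cframe Φ W w) (hψU : ψ ∉ Φ w) (hψQ : ∀ u ∈ W, ψ ∉ cframe Φ W u → u = q ∨ u = v) : False := by
  obtain ⟨l, hlW, hl⟩ := hW
  subst hlW
  have hfr : ∀ u ∈ l, frameIn Φ l u = cframe Φ l.toFinset u := fun u hu => frameIn_eq_cframe Φ hΦ hΦne hl hu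
  refine false_of_cross_annihilators Φ hΦ hl (List.mem_toFinset.1 hv) (List.mem_toFinset.1 hw)
    (by rwa [hfr v (List.mem_toFinset.1 hv)]) hχU (fun u hu h => hχQ u (List.mem_toFinset.2 hu) (by rwa [← hfr u hu]))
    (by rwa [hfr w (List.mem_toFinset.1 hw)]) hψU (fun u hu h => hψQ u (List.mem_toFinset.2 hu) (by rwa [← hfr u hu]))

/-- **T′ via canonical frames**: an annihilator point of a member of a structured family fails the canonical frames of at least two other
members. [this work] -/
theorem two_le_card_cfail_of_annihilator (hΦ : ∀ k, IsUpperSet (Φ k)) (hΦne : ∀ k, (Φ k).Nonempty) {W : Finset κ}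
    (hW : Structured Φ W) {u : κ} (hu : u ∈ W) {φ : Set ι} (hφA : φ ∈ cframe Φ W u) (hφU : φ ∉ Φ u) :
    2 ≤ ((W.erase u).filter fun w => φ ∉ cframe Φ W w).card := by
  obtain ⟨l, hlW, hl⟩ := hW
  subst hlW
  have hul : u ∈ l := List.mem_toFinset.1 hu
  have hfr : ∀ x ∈ l, frameIn Φ l x = cframe Φ l.toFinset x := fun x hx => frameIn_eq_cframe Φ hΦ hΦne hl hx
  have h2 := two_le_card_frameFail Φ l.length le_rfl hl hΦ φ (Or.inr ⟨u, hul, by rwa [hfr u hul], hφU⟩)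
  refine h2.trans (card_le_card fun w hw => ?_)
  rw [mem_frameFail] at hw
  rw [mem_filter, mem_erase, List.mem_toFinset]
  refine ⟨⟨fun hwu => hw.2 ?_, hw.1⟩, by rw [← hfr w hw.1]; exact hw.2⟩
  rw [hwu, hfr u hul]; exact hφA

end Chain

/-! ### The glued field: two failures, the product formula, antipodality -/

section Glued

variable (U : κ → Set (Set ι)) (W : Finset κ)

/-- **(F2): a non-empty configuration of the glued annihilator of `w` fails the glued frames of at least two other members.** [this work] -/
theorem two_le_card_gfail (hU : ∀ k, IsUpperSet (U k)) (hne : ∀ k, (U k).Nonempty) (hS : ∀ h, Structured (faceT U h) W)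
    {w : κ} (hw : w ∈ W) {χ : Set ι} (hχ : χ ∈ gann U W w) (hχne : χ.Nonempty) :
    2 ≤ ((W.erase w).filter fun j => χ ∉ gframe U W j).card := by
  obtain ⟨h, hh⟩ := hχne
  have hΦU : ∀ k, IsUpperSet (faceT U h k) := isUpperSet_faceT U hU h
  have hΦne : ∀ k, (faceT U h k).Nonempty := faceT_nonempty U hU hne h
  have hχA : χ ∈ cframe (faceT U h) W w := (mem_gframe_iff_of_mem U W hU hne hS hw hh).1 hχ.1
  have hχU : χ ∉ faceT U h w := by
    intro h'
    rw [faceT_apply, mem_secAt] at h'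
    simp only [forceAt, cond_true, Set.insert_eq_of_mem hh] at h'
    exact hχ.2 h'
  refine (two_le_card_cfail_of_annihilator (faceT U h) hΦU hΦne (hS h) hw hχA hχU).trans (card_le_card fun j hj => ?_)
  rw [mem_filter] at hj ⊢
  exact ⟨hj.1, fun hg => hj.2 ((mem_gframe_iff_of_mem U W hU hne hS (mem_of_mem_erase hj.1) hh).1 hg)⟩

/-- **`⋂ gframe = ⋂ U` off the bottom point**: a non-empty configuration lying in every glued frame lies in every member. [this work] -/
theorem mem_of_forall_mem_gframe (hU : ∀ k, IsUpperSet (U k)) (hne : ∀ k, (U k).Nonempty) (hS : ∀ h, Structured (faceT U h) W)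
    {ω : Set ι} (hωne : ω.Nonempty) (hω : ∀ j ∈ W, ω ∈ gframe U W j) {w : κ} (hw : w ∈ W) : ω ∈ U w := by
  by_contra hωU
  have h2 := two_le_card_gfail U W hU hne hS hw ⟨hω w hw, hωU⟩ hωne
  have h0 : ((W.erase w).filter fun j => ω ∉ gframe U W j) = ∅ :=
    filter_eq_empty_iff.2 fun j hj hn => hn (hω j (mem_of_mem_erase hj))
  rw [h0, card_empty] at h2
  exact absurd h2 (by norm_num)

/-- A configuration missing a coordinate read by no glued frame (a CONE POINT) and otherwise full lies in every member:
`univ ∖ {g} ∈ U w` whenever `g ∉ esupp (gframe U W j)` for all `j` (needs a second coordinate). [this work] -/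
theorem univ_diff_mem_of_forall_not_mem_esupp (hU : ∀ k, IsUpperSet (U k)) (hne : ∀ k, (U k).Nonempty)
    (hS : ∀ h, Structured (faceT U h) W) {g : ι} (hg : ∀ j ∈ W, g ∉ esupp (gframe U W j)) (h2 : ∃ h : ι, h ≠ g) {w : κ}
    (hw : w ∈ W) : Set.univ \ {g} ∈ U w := by
  obtain ⟨h, hhg⟩ := h2
  refine mem_of_forall_mem_gframe U W hU hne hS (ω := Set.univ \ {g}) ⟨h, Set.mem_univ h, hhg⟩ (fun j hj => ?_) hw
  have huniv : Set.univ ∈ gframe U W j :=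
    univ_mem_of_nonempty (isUpperSet_gframe U W hU j) ⟨_, subset_gframe U W hU j (univ_mem_of_nonempty (hU j) (hne j))⟩
  have := (insert_mem_iff_of_not_affects (isUpperSet_gframe U W hU j) (fun ha => hg j hj (mem_esupp.2 ha)) (Set.univ \ {g})).1
  refine this ?_
  rwa [Set.insert_sdiff_singleton, Set.insert_eq_of_mem (Set.mem_univ g)]

/-- **Antipodality, one contraction face** (TIGHTNESS-III 2.6): annihilator points `χ ∈ gann v` failing at most the glued frames of `p, w`
and `ψ ∈ gann w` failing at most those of `q, v` cannot share a coordinate `h`. [this work] -/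
theorem false_of_cross_gann (hU : ∀ k, IsUpperSet (U k)) (hne : ∀ k, (U k).Nonempty) (hS : ∀ h, Structured (faceT U h) W)
    {v w p q : κ} (hv : v ∈ W) (hw : w ∈ W) {χ ψ : Set ι} (hχ : χ ∈ gann U W v) (hψ : ψ ∈ gann U W w)
    (hχQ : ∀ u ∈ W, χ ∉ gframe U W u → u = p ∨ u = w) (hψQ : ∀ u ∈ W, ψ ∉ gframe U W u → u = q ∨ u = v)
    {h : ι} (hhχ : h ∈ χ) (hhψ : h ∈ ψ) : False := by
  have hΦU : ∀ k, IsUpperSet (faceT U h k) := isUpperSet_faceT U hU h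
  have hΦne : ∀ k, (faceT U h k).Nonempty := faceT_nonempty U hU hne h
  have hmemU : ∀ {x : κ} {ω : Set ι}, h ∈ ω → ω ∈ gann U W x → ω ∉ faceT U h x := by
    intro x ω hhω hω h'
    rw [faceT_apply, mem_secAt] at h'
    simp only [forceAt, cond_true, Set.insert_eq_of_mem hhω] at h'
    exact hω.2 h'
  refine false_of_cross_annihilators_cframe (faceT U h) hΦU hΦne (hS h) hv hw
    ((mem_gframe_iff_of_mem U W hU hne hS hv hhχ).1 hχ.1) (hmemU hhχ hχ)
    (fun u hu hcu => hχQ u hu fun hg => hcu ((mem_gframe_iff_of_mem U W hU hne hS hu hhχ).1 hg))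
    ((mem_gframe_iff_of_mem U W hU hne hS hw hhψ).1 hψ.1) (hmemU hhψ hψ)
    (fun u hu hcu => hψQ u hu fun hg => hcu ((mem_gframe_iff_of_mem U W hU hne hS hu hhψ).1 hg))

end Glued

end GluedFrames

end Summit.CriticalPhenomena.PercolationContinuityZ3.Theorems
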